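import Literature.Analysis.FluidPDE.VorticitySupEnstrophyGronwall
import Summits.NavierStokesRegularity.NavierStokesRegularity.Theorems.CertifiedBlowupCertifiedBlowupAxisymBlowupEnstrophyRate
import HarnessLib

/-!
# Certificate class `CertifiedBlowupVorticityRateBlowup` (stmt-NavierStokesRegularity-8639): THE CERTIFICATE CONSTANT
# HAS A UNIVERSAL FLOOR — `(T − t)‖ω(t)‖_∞ ≤ C` near `T⁻` forces `C ≥ 1/4`

Theorems file landed `--supports stmt-NavierStokesRegularity-8639` (cell `ns-blowup`, GROUP B zone Z1 → the certificate
crux; sixth crux-side deposit of the zone-Z1 seat, lead letter (kt)(4)). The certificate class consists of the maximal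
Leray–Hopf classical solutions `(u, p)` of viscosity `ν > 0` and finite lifespan `T` from a rapidly decaying axisymmetric
datum obeying the dynamic-rescaling rate `(T − t)‖curl u(t)‖_∞ ≤ C` for `t` near `T⁻`. The constant `C` is dimensionless.
This file proves that it cannot be small:

* `integral_sq_norm_curl_step` — ONE SLAB: if `‖curl u(t, x)‖ ≤ C/(T − t₂)` on `[t₁, t₂] ⊂ [0, T)`, then
  `∫|ω(t₂)|² ≤ ∫|ω(t₁)|² · exp(2C(t₂ − t₁)/(T − t₂))` (the tree's RRS 2016 (12.12) slab Grönwall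
  `integral_sq_norm_curl_le_mul_exp_of_norm_curl_le`, time-translated);
* `integral_sq_norm_curl_geometric` — GEOMETRIC SLABS `tₙ = T − (T − t₀)q^{−n}`, `q > 1`: under the rate on `[t₀, T)`,
  `∫|ω(tₙ)|² ≤ ∫|ω(t₀)|² · exp(2C(q − 1))ⁿ` (each slab costs the factor `exp(2C(q − 1))`, independently of `n`);
* `leray_le_integral_sq_norm_curl` — Leray's enstrophy rate read on the vorticity: `c ν^{3/2}/√(T − t) ≤ ∫|ω(t)|²` for
  every `t ∈ [0, T)` (the tree's `enstrophy_rate_of_isMaximalSmoothSolution` and the `div`–`curl` inequality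
  `∫|∇u|²_F ≤ ∫|ω|²`);
* `log_le_of_vorticityRate` — comparing the two along `tₙ`: `√q ≤ exp(2C(q − 1))`, i.e. `log q ≤ 4C(q − 1)`, for EVERY
  `q > 1` (otherwise `(√q · e^{−2C(q−1)})ⁿ → ∞` against the fixed bound `∫|ω(t₀)|² √(T − t₀)/(cν^{3/2})`);
* `quarter_le_of_vorticityRate` — **hence `1/4 ≤ C`** (`log q ≥ 1 − 1/q`, so `1/(4q) ≤ C` for all `q > 1`);
* `vorticityRate_witness_const_ge_quarter` — assembled for every witness of the certificate class and every admissible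
  constant: `C ≥ 1/4`; `vorticityRate_witness_frequently_gt` — equivalently `limsup_{t → T⁻} (T − t)‖ω(t)‖_∞ ≥ 1/4`: for
  every `C' < 1/4`, frequently near `T⁻` some point has `(T − t)‖ω(t, x)‖ > C'`;
* `vorticityRateExclusion_below_quarter` — THE KILL STATEMENT `CertifiedBlowupVorticityRateExclusion` (crux #4, ¬#3 up to
  logic) HOLDS FOR EVERY CONSTANT `C < 1/4`: its text with `∀ C` replaced by `∀ C < 1/4`, verbatim otherwise.

READING (quantitative Beale–Kato–Majda): BKM says `∫^T ‖ω‖_∞ = ∞` at a singular time; the enstrophy Grönwall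
`d/dt‖ω‖₂² ≤ 2‖ω‖_∞‖ω‖₂²` against Leray's `‖∇u(t)‖₂² ≥ cν^{3/2}(T − t)^{−1/2}` says more — the divergence is at least
`¼ log(1/(T − t)) − K`, so a Type-I vorticity certificate needs `C ≥ 1/4`. The axisymmetry of the datum is carried only
because the tree's Leray rate at the crux carries it; the argument uses no symmetry. The constant `1/4` is what the printed
chain (RRS (12.11) with `‖∇u‖₂ = ‖ω‖₂`) yields; it is not claimed sharp.

No new definitions, no named-fact hypotheses, no `sorry`. WHAT THIS IS NOT: not a blow-up or regularity claim — an a priori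
inequality about a HYPOTHETICAL witness of the certificate class; crux 8639, crux 8640 and (AX-L) are untouched (8640 is
proved only below the threshold `C < 1/4`). Author: ns-blowup-profile-eng-1 g11, 2026-08-27.

## References
* J. C. Robinson, J. L. Rodrigo, W. Sadowski, *The Three-Dimensional Navier–Stokes Equations*, CUP 2016, Thm 12.3
  (12.11)–(12.12). [RobinsonRodrigoSadowski2016]
* J. Leray, Acta Math. 63 (1934), §20 (3.12). [Leray1934]
* J. T. Beale, T. Kato, A. Majda, Comm. Math. Phys. 94 (1984). [BealeKatoMajda1984]
-/

-- the summit and its single problem share the name (D-0017 nested layout)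
set_option linter.dupNamespace false

noncomputable section

open MeasureTheory Set Function Filter Topology Metric
open scoped ENNReal NNReal RealInnerProductSpace

namespace Summit.NavierStokesRegularity.NavierStokesRegularity.Theorems.CertifiedBlowupVorticityRateBlowup.ConstantFloor

open Literature.Analysis.FluidPDE
open Summit.NavierStokesRegularity.NavierStokesRegularity.Theorems.CertifiedBlowupAxisymBlowup.CompactAmplification

variable {ν T : ℝ} {u : ℝ → EuclideanSpace ℝ (Fin 3) → EuclideanSpace ℝ (Fin 3)}
  {p : ℝ → EuclideanSpace ℝ (Fin 3) → ℝ}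

/-! ### One slab and geometric slabs -/

/-- **One slab.** Let `(u, p)` be a classical unforced solution on `[0, T) × ℝ³`, `ν > 0`, in the Beale–Kato–Majda class
on every `[0, T'']`, `T'' < T`, and let `0 ≤ t₁ < t₂ < T` with `‖curl u(t, x)‖ ≤ C/(T − t₂)` for all
`t ∈ [t₁, t₂]`, `x`. Then `∫|curl u(t₂)|² ≤ (∫|curl u(t₁)|²) · exp(2 (C/(T − t₂)) (t₂ − t₁))` — the tree's RRS (12.12)
slab bound `integral_sq_norm_curl_le_mul_exp_of_norm_curl_le` for the translate `u(· + t₁)` on `[0, t₂ − t₁]`.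
[cite: RobinsonRodrigoSadowski2016, Thm 12.3 (12.12)] -/
theorem integral_sq_norm_curl_step (hν : 0 < ν) (hcl : IsClassicalNSSolutionOn (Ico 0 T) ν 0 u p)
    (hreg : ∀ T'' < T, HasBoundedSobolevNormsOn (Icc 0 T'') u) {C t₁ t₂ : ℝ} (ht₁ : 0 ≤ t₁)
    (h12 : t₁ < t₂) (ht₂ : t₂ < T) (hω : ∀ t ∈ Icc t₁ t₂, ∀ x, ‖curl (u t) x‖ ≤ C / (T - t₂)) :
    ∫ x, ‖curl (u t₂) x‖ ^ 2 ≤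
      (∫ x, ‖curl (u t₁) x‖ ^ 2) * Real.exp (2 * (C / (T - t₂)) * (t₂ - t₁)) := by
  set v : ℝ → EuclideanSpace ℝ (Fin 3) → EuclideanSpace ℝ (Fin 3) := fun s => u (s + t₁) with hv
  have hd : 0 < t₂ - t₁ := sub_pos.2 h12
  have hS : IsClassicalNSSolutionOn (Icc 0 (t₂ - t₁)) ν 0 v (fun s => p (s + t₁)) :=
    (hcl.translate_Ico_zero ht₁).mono (Icc_subset_Ico_right (by linarith)) (uniqueDiffOn_Icc hd)
  have hB : HasBoundedSobolevNormsOn (Icc 0 (t₂ - t₁)) v := fun n => by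
    obtain ⟨Cn, hCn⟩ := hreg t₂ ht₂ n
    exact ⟨Cn, fun s hs => hCn (s + t₁) ⟨by linarith [hs.1], by linarith [hs.2]⟩⟩
  have hΩ : ∀ s ∈ Icc 0 (t₂ - t₁), ∀ x, ‖curl (v s) x‖ ≤ C / (T - t₂) := fun s hs x =>
    hω (s + t₁) ⟨by linarith [hs.1], by linarith [hs.2]⟩ x
  have h := integral_sq_norm_curl_le_mul_exp_of_norm_curl_le hν hd hS hB hΩ (t₂ - t₁) ⟨hd.le, le_rfl⟩
  simpa only [hv, sub_add_cancel, zero_add] using h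

/-- **Geometric slabs.** Under `(T − t)‖curl u(t, x)‖ ≤ C` on `[t₀, T) × ℝ³` (`0 ≤ t₀ < T`), for every `q > 1` and
`n ∈ ℕ`: `∫|curl u(tₙ)|² ≤ (∫|curl u(t₀)|²) · exp(2C(q − 1))ⁿ`, `tₙ = T − (T − t₀)/qⁿ` — on the slab `[tₙ, tₙ₊₁]` the
vorticity is at most `C/(T − tₙ₊₁)` and `2 (C/(T − tₙ₊₁)) (tₙ₊₁ − tₙ) = 2C(q − 1)`. [new here — elementary] -/
theorem integral_sq_norm_curl_geometric (hν : 0 < ν) (hcl : IsClassicalNSSolutionOn (Ico 0 T) ν 0 u p)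
    (hreg : ∀ T'' < T, HasBoundedSobolevNormsOn (Icc 0 T'') u) {C t₀ : ℝ} (ht₀ : 0 ≤ t₀) (ht₀T : t₀ < T)
    (hω : ∀ t ∈ Ico t₀ T, ∀ x, (T - t) * ‖curl (u t) x‖ ≤ C) {q : ℝ} (hq : 1 < q) (n : ℕ) :
    ∫ x, ‖curl (u (T - (T - t₀) / q ^ n)) x‖ ^ 2 ≤
      (∫ x, ‖curl (u t₀) x‖ ^ 2) * Real.exp (2 * C * (q - 1)) ^ n := by
  set a : ℝ := T - t₀ with ha
  have ha0 : 0 < a := sub_pos.2 ht₀T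
  have hq0 : 0 < q := by linarith
  induction n with
  | zero => simp [ha]
  | succ n ih =>
    -- the slab `[tₙ, tₙ₊₁]`
    have hqn : 0 < q ^ n := pow_pos hq0 n
    have hqn1 : 0 < q ^ (n + 1) := pow_pos hq0 (n + 1)
    have h1qn : 1 ≤ q ^ n := one_le_pow₀ hq.le
    have hlt : a / q ^ (n + 1) < a / q ^ n := by
      rw [div_lt_div_iff_of_pos_left ha0 hqn1 hqn, pow_succ]
      exact lt_mul_of_one_lt_right hqn hq
    have hle : a / q ^ n ≤ a := div_le_self ha0.le h1qn
    have hpos : 0 < a / q ^ (n + 1) := div_pos ha0 hqn1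
    have ht₁ : 0 ≤ T - a / q ^ n := by linarith
    have h12 : T - a / q ^ n < T - a / q ^ (n + 1) := by linarith
    have ht₂ : T - a / q ^ (n + 1) < T := by linarith
    have hC0 : 0 ≤ C := by
      have h := hω t₀ ⟨le_rfl, ht₀T⟩ 0
      exact le_trans (mul_nonneg ha0.le (norm_nonneg _)) h
    have hωslab : ∀ t ∈ Icc (T - a / q ^ n) (T - a / q ^ (n + 1)), ∀ x,
        ‖curl (u t) x‖ ≤ C / (T - (T - a / q ^ (n + 1))) := by
      intro t ht x
      have htI : t ∈ Ico t₀ T := ⟨by linarith [ht.1], by linarith [ht.2]⟩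
      have hTt : 0 < T - t := by linarith [ht.2]
      have h := hω t htI x
      rw [le_div_iff₀ (by linarith : 0 < T - (T - a / q ^ (n + 1)))]
      calc ‖curl (u t) x‖ * (T - (T - a / q ^ (n + 1))) ≤ ‖curl (u t) x‖ * (T - t) :=
            mul_le_mul_of_nonneg_left (by linarith [ht.2]) (norm_nonneg _)
        _ = (T - t) * ‖curl (u t) x‖ := mul_comm _ _
        _ ≤ C := h
    have hstep := integral_sq_norm_curl_step hν hcl hreg ht₁ h12 ht₂ hωslab
    -- the exponent is `2C(q − 1)`
    have ha' : a ≠ 0 := ha0.ne'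
    have hq' : q ≠ 0 := hq0.ne'
    have hexp : 2 * (C / (T - (T - a / q ^ (n + 1)))) * (T - a / q ^ (n + 1) - (T - a / q ^ n)) =
        2 * C * (q - 1) := by
      rw [sub_sub_cancel]
      field_simp
      ring
    rw [hexp] at hstep
    calc ∫ x, ‖curl (u (T - a / q ^ (n + 1))) x‖ ^ 2
        ≤ (∫ x, ‖curl (u (T - a / q ^ n)) x‖ ^ 2) * Real.exp (2 * C * (q - 1)) := hstep
      _ ≤ (∫ x, ‖curl (u t₀) x‖ ^ 2) * Real.exp (2 * C * (q - 1)) ^ n * Real.exp (2 * C * (q - 1)) :=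
          mul_le_mul_of_nonneg_right ih (Real.exp_nonneg _)
      _ = (∫ x, ‖curl (u t₀) x‖ ^ 2) * Real.exp (2 * C * (q - 1)) ^ (n + 1) := by rw [pow_succ]; ring

/-! ### Leray's enstrophy rate on the vorticity -/

/-- **Leray's enstrophy rate read on the vorticity** for a witness of the crux: with the absolute constant `c > 0` of the
tree's `enstrophy_rate_of_isMaximalSmoothSolution`, `c ν^{3/2}/√(T − t) ≤ ∫|curl u(t)|²` for every `t ∈ [0, T)` — the
rate `∫|∇u(t)|²_F ≥ cν^{3/2}(T − t)^{−1/2}` and `∫|∇u|²_F ≤ ∫|curl u|²` for divergence-free finite-energy fields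
(`lintegral_frobeniusNormSq_fderiv_le_lintegral_sq_norm_curl`). [cite: Leray1934, §20 (3.12)] -/
theorem leray_le_integral_sq_norm_curl : ∃ c : ℝ, 0 < c ∧ ∀ {ν T : ℝ}
    {u : ℝ → EuclideanSpace ℝ (Fin 3) → EuclideanSpace ℝ (Fin 3)} {p : ℝ → EuclideanSpace ℝ (Fin 3) → ℝ},
    0 < ν → 0 < T → IsMaximalSmoothSolution ν 0 u p T → IsLerayHopfOn T ν 0 (u 0) u →
    HasRapidSpatialDecay (u 0) → IsAxisymmetric (u 0) →
    ∀ t ∈ Ico 0 T, c * ν ^ (3 / 2 : ℝ) / Real.sqrt (T - t) ≤ ∫ x, ‖curl (u t) x‖ ^ 2 := by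
  obtain ⟨c, hc, hler⟩ := enstrophy_rate_of_isMaximalSmoothSolution
  refine ⟨c, hc, fun {ν T u p} hν hT hmax hLH hdec haxi t ht => ?_⟩
  have hreg := hasBoundedSobolevNormsOn_before_of_lerayHopf_classical hν hT hmax.1 hLH hdec
  -- a closed slab containing `t`
  set T'' : ℝ := (t + T) / 2 with hT''
  have htT'' : t ≤ T'' := by rw [hT'']; linarith [ht.2]
  have hT''T : T'' < T := by rw [hT'']; linarith [ht.2]
  have hB : HasBoundedSobolevNormsOn (Icc 0 T'') u := hreg T'' hT''T
  have htS : t ∈ Icc 0 T'' := ⟨ht.1, htT''⟩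
  have hvt := hmax.1.contDiff_velocity ht
  -- finite energy and integrable `|curl u(t)|²`
  have hL2 : ∫⁻ x, ‖u t x‖ₑ ^ 2 < ⊤ := by
    obtain ⟨C0, hC0⟩ := hB 0
    refine lt_of_le_of_lt (le_of_eq (lintegral_congr fun x => ?_)) ((hC0 t htS).trans_lt ENNReal.coe_lt_top)
    rw [← ofReal_norm, ← ofReal_norm, norm_iteratedFDeriv_zero]
  have hcurl_int : Integrable fun x => ‖curl (u t) x‖ ^ 2 := by
    have hfin1 : ∫⁻ x, ‖iteratedFDeriv ℝ 1 (u t) x‖ₑ ^ 2 < ⊤ := by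
      obtain ⟨C1, hC1⟩ := hB 1
      exact (hC1 t htS).trans_lt ENNReal.coe_lt_top
    refine integrable_sq_norm_of_lintegral_lt_top (continuous_curl (hvt.of_le (by norm_cast))) ?_
    exact lt_of_le_of_lt (lintegral_curl_sq_le (u t)) (ENNReal.mul_lt_top ENNReal.ofReal_lt_top hfin1)
  have h1 := hler hν hT hmax hLH hdec haxi t ht
  have h2 := lintegral_frobeniusNormSq_fderiv_le_lintegral_sq_norm_curl (hvt.of_le (by norm_cast))
    (hmax.1.divFree t ht) hL2
  have h3 : (∫⁻ x, ‖curl (u t) x‖ₑ ^ 2) = ENNReal.ofReal (∫ x, ‖curl (u t) x‖ ^ 2) := by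
    rw [show (∫⁻ x, ‖curl (u t) x‖ₑ ^ 2) = ∫⁻ x, ENNReal.ofReal (‖curl (u t) x‖ ^ 2) from
      lintegral_congr fun x => by rw [← ofReal_norm, ENNReal.ofReal_pow (norm_nonneg _)],
      ← ofReal_integral_eq_lintegral_ofReal hcurl_int (Eventually.of_forall fun x => sq_nonneg _)]
  rw [h3] at h2
  exact (ENNReal.ofReal_le_ofReal_iff (integral_nonneg fun x => sq_nonneg _)).1 (h1.trans h2)

/-! ### The floor -/

/-- **`log q ≤ 4C(q − 1)` for every `q > 1`.** For a witness of the crux with `(T − t)‖curl u(t, x)‖ ≤ C` on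
`[t₀, T) × ℝ³`: along `tₙ = T − (T − t₀)q^{−n}`, Leray gives `cν^{3/2}√qⁿ/√(T − t₀) ≤ ∫|ω(tₙ)|²` and the geometric
Grönwall gives `∫|ω(tₙ)|² ≤ ∫|ω(t₀)|² exp(2C(q − 1))ⁿ`; so `(√q/exp(2C(q−1)))ⁿ` is bounded, whence
`√q ≤ exp(2C(q − 1))`. [new here — elementary] -/
theorem log_le_of_vorticityRate (hν : 0 < ν) (hT : 0 < T) (hmax : IsMaximalSmoothSolution ν 0 u p T)
    (hLH : IsLerayHopfOn T ν 0 (u 0) u) (hdec : HasRapidSpatialDecay (u 0)) (haxi : IsAxisymmetric (u 0))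
    {C t₀ : ℝ} (ht₀ : 0 ≤ t₀) (ht₀T : t₀ < T) (hω : ∀ t ∈ Ico t₀ T, ∀ x, (T - t) * ‖curl (u t) x‖ ≤ C)
    {q : ℝ} (hq : 1 < q) : Real.log q ≤ 4 * C * (q - 1) := by
  obtain ⟨c, hc, hler⟩ := leray_le_integral_sq_norm_curl
  have hreg := hasBoundedSobolevNormsOn_before_of_lerayHopf_classical hν hT hmax.1 hLH hdec
  set a : ℝ := T - t₀ with ha
  have ha0 : 0 < a := sub_pos.2 ht₀T
  have hq0 : 0 < q := by linarith
  set E₀ : ℝ := ∫ x, ‖curl (u t₀) x‖ ^ 2 with hE₀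
  set r : ℝ := Real.exp (2 * C * (q - 1)) with hr
  have hr0 : 0 < r := Real.exp_pos _
  set L : ℝ := c * ν ^ (3 / 2 : ℝ) / Real.sqrt a with hL
  have hL0 : 0 < L := div_pos (mul_pos hc (Real.rpow_pos_of_pos hν _)) (Real.sqrt_pos.2 ha0)
  -- the bound `L · (√q)ⁿ ≤ E₀ · rⁿ` for every `n`
  have hbound : ∀ n : ℕ, L * Real.sqrt q ^ n ≤ E₀ * r ^ n := by
    intro n
    have hqn : 0 < q ^ n := pow_pos hq0 n
    have htn : T - a / q ^ n ∈ Ico 0 T := by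
      refine ⟨?_, by linarith [div_pos ha0 hqn]⟩
      have : a / q ^ n ≤ a := div_le_self ha0.le (one_le_pow₀ hq.le)
      linarith
    have h1 := hler hν hT hmax hLH hdec haxi _ htn
    have h2 := integral_sq_norm_curl_geometric hν hmax.1 hreg ht₀ ht₀T hω hq n
    have hsq : Real.sqrt (T - (T - a / q ^ n)) = Real.sqrt a / Real.sqrt q ^ n := by
      rw [sub_sub_cancel, Real.sqrt_div' a (le_of_lt hqn)]
      congr 1
      rw [show q ^ n = (Real.sqrt q ^ n) ^ 2 by rw [← pow_mul, mul_comm, pow_mul, Real.sq_sqrt hq0.le],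
        Real.sqrt_sq (pow_nonneg (Real.sqrt_nonneg _) _)]
    have hLq : c * ν ^ (3 / 2 : ℝ) / Real.sqrt (T - (T - a / q ^ n)) = L * Real.sqrt q ^ n := by
      rw [hsq, hL]
      field_simp
    rw [hLq] at h1
    exact h1.trans h2
  -- hence `√q ≤ r`
  have hsr : Real.sqrt q ≤ r := by
    by_contra hlt
    push Not at hlt
    have hgt : 1 < Real.sqrt q / r := (one_lt_div hr0).2 hlt
    have htop : Tendsto (fun n : ℕ => (Real.sqrt q / r) ^ n) atTop atTop := tendsto_pow_atTop_atTop_of_one_lt hgt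
    have hev := htop.eventually_gt_atTop (E₀ / L)
    obtain ⟨n, hn⟩ := hev.exists
    have h := hbound n
    have : (Real.sqrt q / r) ^ n ≤ E₀ / L := by
      rw [div_pow, div_le_div_iff₀ (pow_pos hr0 n) hL0]
      calc Real.sqrt q ^ n * L = L * Real.sqrt q ^ n := mul_comm _ _
        _ ≤ E₀ * r ^ n := h
    linarith
  -- take logarithms
  have hlog := Real.log_le_log (Real.sqrt_pos.2 hq0) hsr
  rw [Real.log_sqrt hq0.le, hr, Real.log_exp] at hlog
  linarith

/-- **THE FLOOR: `1/4 ≤ C`.** From `log q ≤ 4C(q − 1)` and `1 − 1/q ≤ log q`: `1/(4q) ≤ C` for every `q > 1`, hence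
`C ≥ 1/4`. [new here — elementary] -/
theorem quarter_le_of_vorticityRate (hν : 0 < ν) (hT : 0 < T) (hmax : IsMaximalSmoothSolution ν 0 u p T)
    (hLH : IsLerayHopfOn T ν 0 (u 0) u) (hdec : HasRapidSpatialDecay (u 0)) (haxi : IsAxisymmetric (u 0))
    {C t₀ : ℝ} (ht₀ : 0 ≤ t₀) (ht₀T : t₀ < T) (hω : ∀ t ∈ Ico t₀ T, ∀ x, (T - t) * ‖curl (u t) x‖ ≤ C) :
    1 / 4 ≤ C := by
  have hmain : ∀ q : ℝ, 1 < q → 1 / q ≤ 4 * C := by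
    intro q hq
    have hq0 : 0 < q := by linarith
    have h1 := log_le_of_vorticityRate hν hT hmax hLH hdec haxi ht₀ ht₀T hω hq
    have h2 : 1 - q⁻¹ ≤ Real.log q := Real.one_sub_inv_le_log_of_pos hq0
    have h3 : 1 - q⁻¹ = (q - 1) / q := by field_simp
    have hq1 : 0 < q - 1 := by linarith
    -- `(q − 1)/q ≤ 4C(q − 1)` ⇒ `1/q ≤ 4C`
    have h4 : (q - 1) / q ≤ 4 * C * (q - 1) := by linarith [h3 ▸ h2]
    rw [div_le_iff₀ hq0] at h4
    rw [div_le_iff₀ hq0]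
    nlinarith
  by_contra hlt
  push Not at hlt
  have hC0 : 0 < C := by
    have h := hmain 2 (by norm_num)
    linarith
  -- `q = (1 + 4C)/(8C) > 1` gives `8C/(1 + 4C) ≤ 4C`, i.e. `1 ≤ 4C`
  have hq : 1 < (1 + 4 * C) / (8 * C) := by
    rw [lt_div_iff₀ (by positivity)]; linarith
  have h := hmain _ hq
  rw [one_div_div, div_le_iff₀ (by positivity)] at h
  nlinarith

/-! ### Assembled for the witnesses of the certificate class -/

/-- **CERTIFICATE-CLASS WITNESSES HAVE `C ≥ 1/4`.** For every `(ν, T, u, p)` of the certificate class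
`CertifiedBlowupVorticityRateBlowup` — a maximal Leray–Hopf classical solution of finite lifespan `T` from a rapidly
decaying axisymmetric datum — and every `C` with `(T − t)‖curl u(t, x)‖ ≤ C` for all `x` and all `t` near `T⁻`:
`1/4 ≤ C`. [cite: RobinsonRodrigoSadowski2016, Thm 12.3 (12.11)–(12.12); Leray1934, §20 (3.12)] -/
theorem vorticityRate_witness_const_ge_quarter (hν : 0 < ν) (hT : 0 < T)
    (hmax : IsMaximalSmoothSolution ν 0 u p T) (hLH : IsLerayHopfOn T ν 0 (u 0) u)
    (hdec : HasRapidSpatialDecay (u 0)) (haxi : IsAxisymmetric (u 0)) {C : ℝ}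
    (hrate : ∀ᶠ t in 𝓝[<] T, ∀ x : EuclideanSpace ℝ (Fin 3), (T - t) * ‖curl (u t) x‖ ≤ C) : 1 / 4 ≤ C := by
  obtain ⟨l, hlT, hl⟩ := mem_nhdsLT_iff_exists_Ioo_subset.1 hrate
  have hlT' : l < T := hlT
  set t₀ : ℝ := max 0 ((l + T) / 2) with ht₀
  have ht₀0 : 0 ≤ t₀ := le_max_left _ _
  have ht₀T : t₀ < T := max_lt hT (by linarith)
  have hlt₀ : l < t₀ := lt_of_lt_of_le (by linarith) (le_max_right _ _)
  have hω : ∀ t ∈ Ico t₀ T, ∀ x, (T - t) * ‖curl (u t) x‖ ≤ C := fun t ht =>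
    hl ⟨lt_of_lt_of_le hlt₀ ht.1, ht.2⟩
  exact quarter_le_of_vorticityRate hν hT hmax hLH hdec haxi ht₀0 ht₀T hω

/-- **Equivalently: `limsup_{t → T⁻} (T − t)‖curl u(t)‖_∞ ≥ 1/4`** — for every witness of the certificate class (indeed
for every maximal Leray–Hopf classical solution of finite lifespan from a rapidly decaying axisymmetric datum) and every
`C' < 1/4`, frequently as `t → T⁻` some point `x` has `C' < (T − t)‖curl u(t, x)‖`.
[cite: RobinsonRodrigoSadowski2016, Thm 12.3 (12.11)–(12.12); Leray1934, §20 (3.12)] -/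
theorem vorticityRate_witness_frequently_gt (hν : 0 < ν) (hT : 0 < T)
    (hmax : IsMaximalSmoothSolution ν 0 u p T) (hLH : IsLerayHopfOn T ν 0 (u 0) u)
    (hdec : HasRapidSpatialDecay (u 0)) (haxi : IsAxisymmetric (u 0)) {C' : ℝ} (hC' : C' < 1 / 4) :
    ∃ᶠ t in 𝓝[<] T, ∃ x : EuclideanSpace ℝ (Fin 3), C' < (T - t) * ‖curl (u t) x‖ := by
  by_contra h
  rw [Filter.not_frequently] at h
  have h' : ∀ᶠ t in 𝓝[<] T, ∀ x : EuclideanSpace ℝ (Fin 3), (T - t) * ‖curl (u t) x‖ ≤ C' :=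
    h.mono fun t ht x => not_lt.1 fun hx => ht ⟨x, hx⟩
  exact (not_le.2 hC') (vorticityRate_witness_const_ge_quarter hν hT hmax hLH hdec haxi h')

/-- **THE KILL STATEMENT BELOW THE THRESHOLD.** The text of crux #4 `CertifiedBlowupVorticityRateExclusion` with `∀ C`
restricted to `∀ C < 1/4` (verbatim otherwise): every maximal Leray–Hopf classical solution of finite lifespan `T > 0`
from a rapidly decaying axisymmetric datum, any `ν > 0`, has, for every `C < 1/4`, frequently near `T⁻` a point with
`C < (T − t)‖curl u(t, x)‖`. The certificate class with constant `< 1/4` is empty.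
[cite: RobinsonRodrigoSadowski2016, Thm 12.3 (12.11)–(12.12); Leray1934, §20 (3.12)] -/
theorem vorticityRateExclusion_below_quarter : ∀ ν : ℝ, 0 < ν → ∀ T : ℝ, 0 < T →
    ∀ (u : ℝ → EuclideanSpace ℝ (Fin 3) → EuclideanSpace ℝ (Fin 3)) (p : ℝ → EuclideanSpace ℝ (Fin 3) → ℝ),
    IsMaximalSmoothSolution ν 0 u p T → IsLerayHopfOn T ν 0 (u 0) u → HasRapidSpatialDecay (u 0) →
    IsAxisymmetric (u 0) → ∀ C : ℝ, C < 1 / 4 →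
    ∃ᶠ t in 𝓝[<] T, ∃ x : EuclideanSpace ℝ (Fin 3), C < (T - t) * ‖curl (u t) x‖ :=
  fun _ hν _ hT _ _ hmax hLH hdec haxi _ hC =>
    vorticityRate_witness_frequently_gt hν hT hmax hLH hdec haxi hC

end Summit.NavierStokesRegularity.NavierStokesRegularity.Theorems.CertifiedBlowupVorticityRateBlowup.ConstantFloor

end
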